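import Summits.HubbardSuperconductivity.HubbardSuperconductivity.Theses.NodalDiracTwist
import Literature.MathematicalPhysics.QuantumLattice.SpinTwistedHubbardTorus

/-!
# Route `NodalDiracTwist` — support `TwistAtZero`

`TwistAtZero` (stmt-HubbardSuperconductivity-1628): for `L ≥ 3` the spin-twisted Hubbard torus
inlined in the route's items, `H_L(U, φ) = -Σ_{x,μ,σ} (e^{i(-1)^σ φ_μ/L} c†_{xσ} c_{x+e_μ,σ} + h.c.)
+ U Σ_x n_{x↑} n_{x↓}`, reduces at `φ = 0` to `hubbardTorus 2 L 1 U`. The inlined `let H` is by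
`rfl` the tree's `spinTwistedHubbardTorus L U` (`spinTwistedHubbardTorus_eq_inline`), and the
untwisted point is the tree's `spinTwistedHubbardTorus_zero` (the neighbours of `x` on a torus of
side `≥ 3` are the four distinct sites `x ± e_μ`).

Sources: E. H. Lieb, Phys. Rev. Lett. 62 (1989) 1201, eq. (1); S. Karakuzu, K. Seki, S. Sorella,
Phys. Rev. B 98 (2018) 075156, Sec. II D. No new definitions.
-/

-- the mandated namespace `Summit.<Summit>.<Problem>.Theorems` repeats `HubbardSuperconductivity`
-- (single-problem summit, D-0017), which the `dupNamespace` linter flags on every declaration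
set_option linter.dupNamespace false

namespace Summit.HubbardSuperconductivity.HubbardSuperconductivity.Theorems.NodalDiracTwist

open Literature.MathematicalPhysics.QuantumLattice
open Summit.HubbardSuperconductivity.HubbardSuperconductivity.Theses.NodalDiracTwist

/-- **`TwistAtZero`** (stmt-HubbardSuperconductivity-1628): `H_L(U, 0) = hubbardTorus 2 L 1 U` for
`L ≥ 3` — the tree's `spinTwistedHubbardTorus_zero`, the inlined `let H` being
`spinTwistedHubbardTorus L U` by `rfl`. Lieb, PRL 62 (1989) 1201, eq. (1). [folklore] -/
theorem twistAtZero_proof :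
    Summit.HubbardSuperconductivity.HubbardSuperconductivity.Theses.NodalDiracTwist.TwistAtZero := by
  intro L _ hL U
  exact spinTwistedHubbardTorus_zero L hL U

end Summit.HubbardSuperconductivity.HubbardSuperconductivity.Theorems.NodalDiracTwist
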